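/-
Copyright (c) 2026 the pub-hodgecm-mathlib formalisation cell (harness21).  Prover seat hodgecm-mathlib-K2Liu-p03 (g9), Track B «K2-LIT» ∕ hLiu418 #184♮ =
`stmt-HodgeConjecture-24832`, socket #41 KIND 1, block K1-b♮ (dec-2-pay) F3-asm (LEAD F0P6-plan (g16) BATCH #275∕#278, 2026-09-05T03:15Z): «THE FINITE HALF
`∏_{v∈T(x)} W_{i,v}(s,x)` OF THE LINE WHITTAKER COEFFICIENT IS POLYNOMIALLY BOUNDED IN THE TRANSLATE'S HEIGHT, GIVEN ONE PER-PLACE SIZE LETTER» — the payer-side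
assembler of K2Liu-p11 (g6)'s F1 `hFfin` binder.  THEOREMS ONLY (no `def`, no `instance`, no notation, no named-fact hypothesis, no `sorry`);
lane `--supports stmt-HodgeConjecture-24832 --as helper`.
-/
import Summits.HodgeConjecture.HodgeConjecture.Theorems.K2LiuClosedSubgroupHeightBallVolume      -- ★ `finprod_localHeight_le_mul_adelicHeightGL` (`∏ᶠ_w H_w(x) ≤ N·‖x‖`)
import Summits.HodgeConjecture.HodgeConjecture.Theorems.K2LiuKindWFinitePartLettersOfRecord      -- ★ `prod_placesOver_eq_prod_biUnion` (the fibres `{w ∣ v}` as one `Finset`)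
import Summits.HodgeConjecture.HodgeConjecture.Theorems.K2LiuKindWPlacesCount                    -- ★ `prod_le_finprod_of_one_le`
import Literature.NumberTheory.Automorphic.AutomorphicLFunctionProofs                            -- ★ `summable_residueCard_rpow_neg` (`∑_v q_v^{−σ} < ∞`, `σ > 1`)
import Literature.NumberTheory.Automorphic.AdelicHeightGLProofs                                  -- ★ `GLn.one_le_localHeight`, `adelicHeightGL_nonneg`
import Literature.NumberTheory.Automorphic.LeviEmbeddingGLHeight                                 -- ★ `GLn.hasFiniteMulSupport_localHeight`
import HarnessLib

/-!
# Crux `HLiu418`, socket #41, KIND 1 b♮ (dec-2-pay) F3-asm — `K2LiuKindOneLineFiniteHalfBound`: THE FINITE-HALF SIZE LETTER `hFfin` FROM ONE PER-PLACE SIZE LETTER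

Cell `hodgecm-mathlib`, crux item hLiu418 = `stmt-HodgeConjecture-24832` (helper lane, count-neutral).  Namespace `…Cruxes.HLiu418.K2LiuKindOneLineFiniteHalfBound`.
WHY.  K2Liu-p11 (g6)'s F1 `K2LiuKindOneLineBlockLetterOfRecord.blockLetter_rate_of_record` (the K1-b♮ block letter `hBL₁` of ★ p864699) is hypothesis-first on the
finite-half size letter `hFfin : ‖Ffin i x s‖ ≤ Cf · ‖Λ₀γ̂·h‖^{af}` near every `z` with `0 < re z`, where `Ffin i x s = ∏_{v ∈ T(x)} W_{i,v}(s, x)` is the product over the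
line's bad set `T(x) = kindWFinset …` of the local rank-one Whittaker-type integrals of the `i`-th tensor factor of the pulled-back family at the translate `x`
(LH4-p09 (g11)'s F2 `hchain₁`).  At `n = 1`, inner parameter `s + ½`, those local integrals converge ABSOLUTELY on the whole window (`|b|_v^{−(2 re s + 2)}` on the far
shells), so the per-place size letter has the shape
`‖W_{i,v}(s,x)‖ ≤ (q_v^{cf v} · ∏_{w∣v} H_w(x))^{Mf} · (1 + 2 q_v^{−(1+ε)})`, with the exponent `cf` SUPPORTED ON A FIXED FINITE SET `Tf` (level of the family ∪ conductor
of `ψ` ∪ the datum's bad places) and `Mf, ε` uniform — and THIS FILE is the arithmetic from that letter to `hFfin`, GENERIC in the index type `X` (whatever F1 quantifies: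
`(S, u, w, hw, S′, h)`), the tensor index `ι`, the bad-set map `T : X → Finset v`, and the height reading `Ht : X → GL_N(𝔸_L)` (F1: `Ht x = ↑(Λ₀ γ̂ · h)`, `N = 2 + 2`):
* §1 tools — **`exists_prod_one_add_mul_rpow_neg_le`** (`∏_{v∈T}(1 + c·q_v^{−σ}) ≤ exp(c·∑_v q_v^{−σ})` for EVERY finite `T`, `σ > 1`: ★ `summable_residueCard_rpow_neg` +
  `1 + t ≤ e^t`; this is why NO place count and NO denominator power enters the finite half), **`prod_pow_le_prod_pow_of_support`** (`∏_{v∈T} q_v^{cf v} ≤ ∏_{v∈Tf} q_v^{cf v}`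
  when `cf = 0` off `Tf`), **`prod_prod_placesOver_localHeight_le`** (`∏_{v∈T}∏_{w∣v} H_w(x) ≤ N·‖x‖`: ★ `prod_placesOver_eq_prod_biUnion` + ★ `prod_le_finprod_of_one_le` +
  ★ `finprod_localHeight_le_mul_adelicHeightGL`);
* §2 **`hFfin_of_placeBounds`** — `∀ z, 0 < re z → ∃ Cf af r, 0 ≤ Cf ∧ 0 ≤ af ∧ 0 < r ∧ ∀ x s, dist s z < r → ∀ i, ‖∏_{v∈T x} W i v s x‖ ≤ Cf · ‖Ht x‖^{af}`
  (`af := Mf`, `Cf := (∏_{v∈Tf} q_v^{cf v})^{Mf} · N^{Mf} · exp(2·∑_v q_v^{−(1+ε)})`).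
References: [KudlaRallis1994, §2 (2.10)–(2.12)]; [BorelJacquet1979, §1.2]; [MoeglinWaldspurger1995, I.2.2, II.1.7]; [Casselman1980, §3]; [NeukirchANT1999, Ch. VII §8];
[Shimura1997, §18.4 Prop. 18.14].  HONEST LABEL: HC_CM is proved only modulo the 7 printed citations (2 remaining named inputs: hLiu418 = stmt-HodgeConjecture-24832,
h413 = stmt-HodgeConjecture-24833) until rung 0 closes; count-neutral helper (`--supports stmt-HodgeConjecture-24832 --as helper`); the per-place size letter stays BY VALUE
(payer: F3-loc `K2LiuKindOneLineLocalAbsoluteMajorant` at F2's local factors).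
-/

set_option autoImplicit false
set_option linter.dupNamespace false -- the mandated namespace repeats `HodgeConjecture.HodgeConjecture`

noncomputable section

open scoped Matrix NNReal MatrixGroups
open NumberField IsDedekindDomain

namespace Summit.HodgeConjecture.HodgeConjecture.Cruxes.HLiu418.K2LiuKindOneLineFiniteHalfBound

open Literature.NumberTheory.Automorphic Literature.NumberTheory.GaloisRepresentations
open Summit.HodgeConjecture.HodgeConjecture.Cruxes.HLiu418.K2LiuKindWPlacesCount (prod_le_finprod_of_one_le)
open Summit.HodgeConjecture.HodgeConjecture.Cruxes.HLiu418.K2LiuClosedSubgroupHeightBallVolume (finprod_localHeight_le_mul_adelicHeightGL)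
open Summit.HodgeConjecture.HodgeConjecture.Cruxes.HLiu418.K2LiuKindWFinitePartLettersOfRecord (prod_placesOver_eq_prod_biUnion)

/-! ## §1 Tools -/

section Tools

variable (K : Type*) [Field K] [NumberField K]

/-- **ABSOLUTE CONVERGENCE KILLS THE PLACE COUNT**: for `σ > 1` and `c ≥ 0` there is ONE constant `C ≥ 1` with `∏_{v∈T} (1 + c·q_v^{−σ}) ≤ C` for EVERY finite set `T`
of finite places of `K` (`C = exp(c·∑_v q_v^{−σ})`; `1 + t ≤ e^t` and ★ `summable_residueCard_rpow_neg`). [cite: NeukirchANT1999, Ch. VII §8] -/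
theorem exists_prod_one_add_mul_rpow_neg_le {σ c : ℝ} (hσ : 1 < σ) (hc : 0 ≤ c) :
    ∃ C : ℝ, 1 ≤ C ∧ ∀ T : Finset (HeightOneSpectrum (𝓞 K)), ∏ v ∈ T, (1 + c * (v.residueCard : ℝ) ^ (-σ)) ≤ C := by
  have hsum := (summable_residueCard_rpow_neg (K := K) hσ).mul_left c
  refine ⟨Real.exp (∑' v : HeightOneSpectrum (𝓞 K), c * (v.residueCard : ℝ) ^ (-σ)), Real.one_le_exp (tsum_nonneg fun v => by positivity), fun T => ?_⟩
  calc ∏ v ∈ T, (1 + c * (v.residueCard : ℝ) ^ (-σ))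
      ≤ ∏ v ∈ T, Real.exp (c * (v.residueCard : ℝ) ^ (-σ)) :=
        Finset.prod_le_prod (fun v _ => by positivity) fun v _ => by
          have := Real.add_one_le_exp (c * (v.residueCard : ℝ) ^ (-σ)); linarith
    _ = Real.exp (∑ v ∈ T, c * (v.residueCard : ℝ) ^ (-σ)) := (Real.exp_sum _ _).symm
    _ ≤ Real.exp (∑' v : HeightOneSpectrum (𝓞 K), c * (v.residueCard : ℝ) ^ (-σ)) :=
        Real.exp_le_exp.2 (hsum.sum_le_tsum T fun v _ => by positivity)

/-- **A finitely supported exponent costs a constant**: if `cf = 0` off `Tf` then `∏_{v∈T} q_v^{cf v} ≤ ∏_{v∈Tf} q_v^{cf v}` for every finite `T`. [folklore] -/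
theorem prod_pow_le_prod_pow_of_support (cf : HeightOneSpectrum (𝓞 K) → ℕ) (Tf : Finset (HeightOneSpectrum (𝓞 K))) (hcf : ∀ v, v ∉ Tf → cf v = 0)
    (T : Finset (HeightOneSpectrum (𝓞 K))) :
    ∏ v ∈ T, ((v.residueCard : ℕ) : ℝ) ^ cf v ≤ ∏ v ∈ Tf, ((v.residueCard : ℕ) : ℝ) ^ cf v := by
  classical
  have hq1 : ∀ v : HeightOneSpectrum (𝓞 K), (1 : ℝ) ≤ ((v.residueCard : ℕ) : ℝ) := fun v => by exact_mod_cast v.one_lt_residueCard.le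
  have h1 : ∀ v : HeightOneSpectrum (𝓞 K), (1 : ℝ) ≤ ((v.residueCard : ℕ) : ℝ) ^ cf v := fun v => one_le_pow₀ (hq1 v)
  calc ∏ v ∈ T, ((v.residueCard : ℕ) : ℝ) ^ cf v = ∏ v ∈ T ∩ Tf, ((v.residueCard : ℕ) : ℝ) ^ cf v := by
        rw [← Finset.prod_filter_mul_prod_filter_not T (fun v => v ∈ Tf), Finset.filter_mem_eq_inter]
        have h0 : ∏ v ∈ T.filter (fun v => v ∉ Tf), ((v.residueCard : ℕ) : ℝ) ^ cf v = 1 :=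
          Finset.prod_eq_one fun v hv => by rw [hcf v (Finset.mem_filter.1 hv).2, pow_zero]
        rw [h0, mul_one]
    _ ≤ ∏ v ∈ Tf, ((v.residueCard : ℕ) : ℝ) ^ cf v :=
        Finset.prod_le_prod_of_subset_of_one_le Finset.inter_subset_right (fun v _ => zero_le_one.trans (h1 v)) fun v _ _ => h1 v

end Tools

section Heights

variable (L : Type) [Field L] [NumberField L]

/-- **the local heights above a finite set of places of `L⁺` against the adelic height**: `∏_{v∈T} ∏_{w∣v} H_w(x) ≤ N·‖x‖` (`H_w ≥ 1` everywhere, finitely many `≠ 1`,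
`∏ᶠ_w H_w(x) ≤ N·‖x‖` ★). [cite: BorelJacquet1979, §1.2] -/
theorem prod_prod_placesOver_localHeight_le {N : ℕ} [NeZero N] (T : Finset (HeightOneSpectrum (𝓞 ↥(maximalRealSubfield L))))
    (x : GL (Fin N) (AdeleRing (𝓞 L) L)) :
    ∏ v ∈ T, ∏ w' : UnitaryGroup.PlacesOver L v, (GLn.localHeight N L w'.1 x : ℝ) ≤ N * adelicHeightGL N L x := by
  rw [prod_placesOver_eq_prod_biUnion L T (fun w' => (GLn.localHeight N L w' x : ℝ))]
  exact (prod_le_finprod_of_one_le (GLn.hasFiniteMulSupport_localHeight x) (fun w' => by exact_mod_cast GLn.one_le_localHeight w' x) _).trans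
    (finprod_localHeight_le_mul_adelicHeightGL x)

/-- `0 ≤ ∏_{v∈T} ∏_{w∣v} H_w(x)` and `1 ≤` it. [cite: BorelJacquet1979, §1.2] -/
theorem one_le_prod_prod_placesOver_localHeight {N : ℕ} [NeZero N] (T : Finset (HeightOneSpectrum (𝓞 ↥(maximalRealSubfield L))))
    (x : GL (Fin N) (AdeleRing (𝓞 L) L)) :
    1 ≤ ∏ v ∈ T, ∏ w' : UnitaryGroup.PlacesOver L v, (GLn.localHeight N L w'.1 x : ℝ) :=
  Finset.one_le_prod fun v _ => Finset.one_le_prod fun w' _ => by exact_mod_cast GLn.one_le_localHeight w'.1 x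

end Heights

/-! ## §2 The finite-half size letter from the per-place size letter -/

section Head

variable (L : Type) [Field L] [NumberField L]

/-- **(K1b-dec-2-pay) F3-asm: THE FINITE-HALF SIZE LETTER FROM ONE PER-PLACE SIZE LETTER.**  Generic in the index type `X` (F1's `(S, u, w, hw, S′, h)`), the tensor
index type `ι` with its finite range `I x`, the bad-set map `T`, the height reading `Ht` (F1: `x ↦ ↑(Λ₀ γ̂ · h)`, `N := 2 + 2`) and the local letters `W`.  INPUT (by value):
the per-place size letter `hWv` — near every `z` with `0 < re z`: `‖W i v s x‖ ≤ (q_v^{cf v} · ∏_{w∣v} H_w(Ht x))^{Mf} · (1 + 2·q_v^{−(1+ε)})` on `v ∈ T x`, exponent `cf`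
supported on a fixed finite `Tf`, `Mf ε` uniform.  OUTPUT: `‖∏_{v∈T x} W i v s x‖ ≤ Cf · ‖Ht x‖^{af}` near every `z` (`af = Mf`).
[cite: KudlaRallis1994, §2 (2.10)–(2.12)] [cite: BorelJacquet1979, §1.2] [cite: MoeglinWaldspurger1995, I.2.2, II.1.7] [cite: Casselman1980, §3] [cite: NeukirchANT1999, Ch. VII §8] -/
theorem hFfin_of_placeBounds {N : ℕ} [NeZero N] {X ι : Type*}
    (I : X → Finset ι) (T : X → Finset (HeightOneSpectrum (𝓞 ↥(maximalRealSubfield L)))) (Ht : X → GL (Fin N) (AdeleRing (𝓞 L) L))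
    (W : ι → HeightOneSpectrum (𝓞 ↥(maximalRealSubfield L)) → ℂ → X → ℂ)
    (hWv : ∀ z : ℂ, 0 < z.re → ∃ (Mf : ℕ) (cf : HeightOneSpectrum (𝓞 ↥(maximalRealSubfield L)) → ℕ) (Tf : Finset (HeightOneSpectrum (𝓞 ↥(maximalRealSubfield L))))
      (ε r : ℝ), (∀ v, v ∉ Tf → cf v = 0) ∧ 0 < ε ∧ 0 < r ∧
      ∀ (x : X) (s : ℂ), dist s z < r → ∀ i ∈ I x, ∀ v ∈ T x,
        ‖W i v s x‖ ≤ ((((v.residueCard : ℕ) : ℝ) ^ cf v) * ∏ w' : UnitaryGroup.PlacesOver L v, (GLn.localHeight N L w'.1 (Ht x) : ℝ)) ^ Mf *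
          (1 + 2 * (v.residueCard : ℝ) ^ (-(1 + ε)))) :
    ∀ z : ℂ, 0 < z.re → ∃ (Cf af r : ℝ), 0 ≤ Cf ∧ 0 ≤ af ∧ 0 < r ∧
      ∀ (x : X) (s : ℂ), dist s z < r → ∀ i ∈ I x, ‖∏ v ∈ T x, W i v s x‖ ≤ Cf * adelicHeightGL N L (Ht x) ^ af := by
  intro z hz
  obtain ⟨Mf, cf, Tf, ε, r, hcf, hε, hr, hW⟩ := hWv z hz
  obtain ⟨Cζ, hCζ1, hCζ⟩ := exists_prod_one_add_mul_rpow_neg_le ↥(maximalRealSubfield L) (σ := 1 + ε) (c := 2) (by linarith) (by norm_num)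
  set Q : ℝ := ∏ v ∈ Tf, ((v.residueCard : ℕ) : ℝ) ^ cf v with hQ
  have hq1 : ∀ v : HeightOneSpectrum (𝓞 ↥(maximalRealSubfield L)), (1 : ℝ) ≤ ((v.residueCard : ℕ) : ℝ) := fun v => by exact_mod_cast v.one_lt_residueCard.le
  have hQ1 : 1 ≤ Q := Finset.one_le_prod fun v _ => one_le_pow₀ (hq1 v)
  refine ⟨(Q * N) ^ Mf * Cζ, Mf, r, by positivity, Nat.cast_nonneg _, hr, fun x s hs i hi => ?_⟩
  set H : ℝ := adelicHeightGL N L (Ht x) with hHdef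
  have hH0 : 0 ≤ H := adelicHeightGL_nonneg _
  -- abbreviations for the three per-place factors
  set P : HeightOneSpectrum (𝓞 ↥(maximalRealSubfield L)) → ℝ := fun v => ∏ w' : UnitaryGroup.PlacesOver L v, (GLn.localHeight N L w'.1 (Ht x) : ℝ) with hP
  have hP1 : ∀ v, 1 ≤ P v := fun v => Finset.one_le_prod fun w' _ => by exact_mod_cast GLn.one_le_localHeight w'.1 (Ht x)
  have hq0 : ∀ v : HeightOneSpectrum (𝓞 ↥(maximalRealSubfield L)), (0 : ℝ) ≤ ((v.residueCard : ℕ) : ℝ) ^ cf v := fun v => pow_nonneg (Nat.cast_nonneg _) _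
  have htail0 : ∀ v : HeightOneSpectrum (𝓞 ↥(maximalRealSubfield L)), (0 : ℝ) ≤ 1 + 2 * (v.residueCard : ℝ) ^ (-(1 + ε)) := fun v => by positivity
  -- the per-place bounds multiplied up
  have hprod : ‖∏ v ∈ T x, W i v s x‖ ≤ ∏ v ∈ T x, ((((v.residueCard : ℕ) : ℝ) ^ cf v * P v) ^ Mf * (1 + 2 * (v.residueCard : ℝ) ^ (-(1 + ε)))) := by
    rw [norm_prod]
    exact Finset.prod_le_prod (fun v _ => norm_nonneg _) fun v hv => hW x s hs i hi v hv
  -- reorganise: `(∏ q^{cf})^{Mf} · (∏ P)^{Mf} · ∏ (1 + 2 q^{−(1+ε)})`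
  have hreorg : ∏ v ∈ T x, ((((v.residueCard : ℕ) : ℝ) ^ cf v * P v) ^ Mf * (1 + 2 * (v.residueCard : ℝ) ^ (-(1 + ε)))) =
      ((∏ v ∈ T x, ((v.residueCard : ℕ) : ℝ) ^ cf v) * ∏ v ∈ T x, P v) ^ Mf * ∏ v ∈ T x, (1 + 2 * (v.residueCard : ℝ) ^ (-(1 + ε))) := by
    rw [Finset.prod_mul_distrib, Finset.prod_pow, Finset.prod_mul_distrib]
  -- the three global bounds
  have h1 : ∏ v ∈ T x, ((v.residueCard : ℕ) : ℝ) ^ cf v ≤ Q := prod_pow_le_prod_pow_of_support ↥(maximalRealSubfield L) cf Tf hcf (T x)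
  have h2 : ∏ v ∈ T x, P v ≤ N * H := prod_prod_placesOver_localHeight_le L (T x) (Ht x)
  have h3 : ∏ v ∈ T x, (1 + 2 * (v.residueCard : ℝ) ^ (-(1 + ε))) ≤ Cζ := hCζ (T x)
  have h12 : (∏ v ∈ T x, ((v.residueCard : ℕ) : ℝ) ^ cf v) * ∏ v ∈ T x, P v ≤ Q * (N * H) :=
    mul_le_mul h1 h2 (Finset.prod_nonneg fun v _ => zero_le_one.trans (hP1 v)) (zero_le_one.trans hQ1)
  have h0 : 0 ≤ (∏ v ∈ T x, ((v.residueCard : ℕ) : ℝ) ^ cf v) * ∏ v ∈ T x, P v :=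
    mul_nonneg (Finset.prod_nonneg fun v _ => hq0 v) (Finset.prod_nonneg fun v _ => zero_le_one.trans (hP1 v))
  rw [show ((Mf : ℕ) : ℝ) = ((Mf : ℕ) : ℝ) from rfl, Real.rpow_natCast]
  calc ‖∏ v ∈ T x, W i v s x‖
      ≤ ((∏ v ∈ T x, ((v.residueCard : ℕ) : ℝ) ^ cf v) * ∏ v ∈ T x, P v) ^ Mf * ∏ v ∈ T x, (1 + 2 * (v.residueCard : ℝ) ^ (-(1 + ε))) := by
        rw [← hreorg]; exact hprod
    _ ≤ (Q * (N * H)) ^ Mf * Cζ :=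
        mul_le_mul (pow_le_pow_left₀ h0 h12 Mf) h3 (Finset.prod_nonneg fun v _ => htail0 v) (by positivity)
    _ = (Q * N) ^ Mf * Cζ * H ^ Mf := by rw [mul_pow, mul_pow, mul_pow]; ring

end Head

end Summit.HodgeConjecture.HodgeConjecture.Cruxes.HLiu418.K2LiuKindOneLineFiniteHalfBound

end
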